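import Summits.ValiantsHypothesis.ValiantsHypothesis.Theorems.BinomialElusivePeelingLemmaGadgetBlockTops

/-!
# The block theta gadget, V: the local side-sum `S⁺` letter by letter

Helper for the crux stmt-ValiantsHypothesis-7391 (negative lane; `Cruxes/PeelingLemma/DETERMINISTIC-ALLX.md`
§3g (b)).  After identifying the two alphabets, the sum of the two sides of a gadget-restricted
relation is `S⁺ = Σ_j Σ_{t<L} a_j(t) · ([birth3 j (2q+t+1) = ·] + [birth3 j t = ·])` (edge `t` of arm
`j` joins the positions `2q+t`, `2q+t+1`; `a = u + v`; `BinomialElusivePeelingLemmaPlusMinus.lean`,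
`side_add_eq`).  This file evaluates `S⁺` on each kind of letter of the block gadget: a private letter
born at vertex `t₀` of arm `j` reads `a_j(t₀-1) + a_j(t₀+2q)` (`plus_apply_private`), the letter
`beta c` reads `Σ_j a_j(2q - blockAge j c)` (`plus_apply_beta`: one edge per arm, the edge on which it
dies), and `beta' c` reads `Σ_j a_j(no+1+blockAge j c)` (`plus_apply_beta'`: the edge on which it is
born).  So `S⁺` is an edge-weighting of the "letter graph" of §3g.  No Theses import.
-/

namespace Summit.ValiantsHypothesis.ValiantsHypothesis.Theorems.PeelingLemmaGadget

-- summit = sub-problem name (single-conjunct summit, D-0017 layout), so the namespace repeats it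
set_option linter.dupNamespace false

open scoped BigOperators
open Finset

variable {q R no : ℕ}

/-- One arm's `S⁺`-sum at a letter `ν`, when `ν` is born on the arm at the top of edge `t₁` only
(`hb`) and dies on the arm on edge `t₂` only (`hd`); `t₁`, `t₂` may lie outside `[0, L)`. -/
theorem arm_plus_apply (f : ℤ → GLetter q no) (a : ℕ → ℤ) (L : ℕ) (ν : GLetter q no) (t₁ t₂ : ℤ)
    (hb : ∀ t : ℕ, f ((2 * q + t + 1 : ℕ) : ℤ) = ν ↔ (t : ℤ) = t₁)
    (hd : ∀ t : ℕ, f (t : ℤ) = ν ↔ (t : ℤ) = t₂) :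
    ∑ t ∈ Finset.range L, a t *
        ((if f ((2 * q + t + 1 : ℕ) : ℤ) = ν then 1 else 0) + (if f (t : ℤ) = ν then 1 else 0)) =
      (∑ t ∈ Finset.range L, if (t : ℤ) = t₁ then a t else 0) +
        ∑ t ∈ Finset.range L, if (t : ℤ) = t₂ then a t else 0 := by
  rw [← Finset.sum_add_distrib]
  refine Finset.sum_congr rfl fun t _ => ?_
  have e1 : (if f ((2 * q + t + 1 : ℕ) : ℤ) = ν then (1 : ℤ) else 0) = if (t : ℤ) = t₁ then 1 else 0 :=
    by by_cases h : (t : ℤ) = t₁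
       · rw [if_pos ((hb t).mpr h), if_pos h]
       · rw [if_neg (fun h' => h ((hb t).mp h')), if_neg h]
  have e2 : (if f (t : ℤ) = ν then (1 : ℤ) else 0) = if (t : ℤ) = t₂ then 1 else 0 := by
    by_cases h : (t : ℤ) = t₂
    · rw [if_pos ((hd t).mpr h), if_pos h]
    · rw [if_neg (fun h' => h ((hd t).mp h')), if_neg h]
  rw [e1, e2]
  split_ifs <;> ring

/-- `Σ_{t<L} [t = t₀] a t` for an integer `t₀`: `a t₀` if `0 ≤ t₀ < L`, else `0`. -/
theorem sum_ite_natCast_eq (a : ℕ → ℤ) (L : ℕ) (t₀ : ℤ) :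
    (∑ t ∈ Finset.range L, if (t : ℤ) = t₀ then a t else 0) =
      if 0 ≤ t₀ ∧ t₀ < L then a t₀.toNat else 0 := by
  split_ifs with h
  · have ht : ((t₀.toNat : ℕ) : ℤ) = t₀ := Int.toNat_of_nonneg h.1
    rw [Finset.sum_eq_single_of_mem t₀.toNat (Finset.mem_range.mpr (by omega))]
    · rw [if_pos ht]
    · intro t _ hne
      rw [if_neg]
      intro h'
      apply hne
      have : (t : ℤ) = ((t₀.toNat : ℕ) : ℤ) := by rw [h', ht]
      exact_mod_cast this
  · refine Finset.sum_eq_zero fun t ht => ?_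
    rw [if_neg]
    intro h'
    apply h
    have := Finset.mem_range.mp ht
    constructor <;> omega

/-- An arm on which `ν` is never born above an edge and never dies contributes `0`. -/
theorem arm_plus_apply_zero (f : ℤ → GLetter q no) (a : ℕ → ℤ) (L : ℕ) (ν : GLetter q no)
    (hb : ∀ t : ℕ, t < L → f ((2 * q + t + 1 : ℕ) : ℤ) ≠ ν) (hd : ∀ t : ℕ, t < L → f (t : ℤ) ≠ ν) :
    ∑ t ∈ Finset.range L, a t *
        ((if f ((2 * q + t + 1 : ℕ) : ℤ) = ν then 1 else 0) + (if f (t : ℤ) = ν then 1 else 0)) = 0 := by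
  refine Finset.sum_eq_zero fun t ht => ?_
  have := Finset.mem_range.mp ht
  rw [if_neg (hb t this), if_neg (hd t this), add_zero, mul_zero]

/-- **`S⁺` at a private letter.**  The letter born at vertex `t₀` (position `2q+t₀`,
`1 ≤ t₀ ≤ no+1`) of arm `j` reads `a_j(t₀-1) + a_j(t₀+2q)` (the second term only if that edge is one
of the `L` edges); the other arms do not see it. -/
theorem plus_apply_private (a : Fin 5 → ℕ → ℤ) (L : ℕ) (j : Fin 5) {t₀ : ℕ} (h1 : 1 ≤ t₀)
    (h2 : t₀ ≤ no + 1) (hL : t₀ ≤ L) :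
    (∑ j', ∑ t ∈ Finset.range L, a j' t *
        ((if birth3 q R no j' ((2 * q + t + 1 : ℕ) : ℤ) = birth3 q R no j ((2 * q + t₀ : ℕ) : ℤ) then 1
            else 0) +
          (if birth3 q R no j' (t : ℤ) = birth3 q R no j ((2 * q + t₀ : ℕ) : ℤ) then 1 else 0))) =
      a j (t₀ - 1) + (if t₀ + 2 * q < L then a j (t₀ + 2 * q) else 0) := by
  rw [Finset.sum_eq_single_of_mem j (Finset.mem_univ j)]
  · rw [arm_plus_apply (birth3 q R no j) (a j) L _ ((t₀ : ℤ) - 1) ((t₀ : ℤ) + 2 * q),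
      sum_ite_natCast_eq, sum_ite_natCast_eq, if_pos ⟨by omega, by omega⟩]
    · have e1 : ((t₀ : ℤ) - 1).toNat = t₀ - 1 := by omega
      rw [e1]
      congr 1
      by_cases h : t₀ + 2 * q < L
      · rw [if_pos ⟨by omega, by omega⟩, if_pos h,
          show ((t₀ : ℤ) + 2 * q).toNat = t₀ + 2 * q by omega]
      · rw [if_neg (fun h' => h (by omega)), if_neg h]
    · intro t
      rw [(birth3_injective j).eq_iff]; push_cast; omega
    · intro t
      rw [(birth3_injective j).eq_iff]; push_cast; omega
  · intro j' _ hj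
    have hp : ∀ τ' : ℤ, birth3 q R no j' τ' ≠ birth3 q R no j ((2 * q + t₀ : ℕ) : ℤ) :=
      fun τ' => birth3_private j (by push_cast; omega) (by push_cast; omega) hj τ'
    exact arm_plus_apply_zero _ _ _ _ (fun t _ => hp _) (fun t _ => hp _)

/-- **`S⁺` at a letter of `b`.**  `beta c` is born inside no edge and dies on arm `j` on the edge
`2q - blockAge j c` (`birth3_eq_beta_iff`): it reads `Σ_j a_j(2q - blockAge j c)` when `2q < L`. -/
theorem plus_apply_beta (a : Fin 5 → ℕ → ℤ) (L : ℕ) (hL : 2 * q < L) (c : Fin (2 * q + 1)) :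
    (∑ j, ∑ t ∈ Finset.range L, a j t *
        ((if birth3 q R no j ((2 * q + t + 1 : ℕ) : ℤ) = GLetter.beta c then 1 else 0) +
          (if birth3 q R no j (t : ℤ) = GLetter.beta c then 1 else 0))) =
      ∑ j, a j (2 * q - ((blockAge q R j c : Fin (2 * q + 1)) : ℕ)) := by
  refine Finset.sum_congr rfl fun j _ => ?_
  have hlt := (blockAge q R j c).isLt
  -- born never (t₁ = -1 is outside), dies at 2q - blockAge
  rw [arm_plus_apply (birth3 q R no j) (a j) L _ (-1)
      ((2 * q : ℤ) - ((blockAge q R j c : Fin (2 * q + 1)) : ℕ)),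
    sum_ite_natCast_eq, sum_ite_natCast_eq, if_neg (by omega), if_pos ⟨by omega, by omega⟩, zero_add,
    show ((2 * q : ℤ) - ((blockAge q R j c : Fin (2 * q + 1)) : ℕ)).toNat
      = 2 * q - ((blockAge q R j c : Fin (2 * q + 1)) : ℕ) by omega]
  all_goals (intro t; rw [birth3_eq_beta_iff]; try omega)

/-- **`S⁺` at a letter of `b'`.**  Among the `no + 2q + 2` edges, `beta' c` dies on none and is born
on arm `j` on the edge `no + 1 + blockAge j c` (`birth3_eq_beta'_iff`): it reads
`Σ_j a_j(no + 1 + blockAge j c)`. -/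
theorem plus_apply_beta' (a : Fin 5 → ℕ → ℤ) (c : Fin (2 * q + 1)) :
    (∑ j, ∑ t ∈ Finset.range (no + 2 * q + 2), a j t *
        ((if birth3 q R no j ((2 * q + t + 1 : ℕ) : ℤ) = GLetter.beta' c then 1 else 0) +
          (if birth3 q R no j (t : ℤ) = GLetter.beta' c then 1 else 0))) =
      ∑ j, a j (no + 1 + ((blockAge q R j c : Fin (2 * q + 1)) : ℕ)) := by
  refine Finset.sum_congr rfl fun j _ => ?_
  have hlt := (blockAge q R j c).isLt
  rw [arm_plus_apply (birth3 q R no j) (a j) _ _ ((no : ℤ) + 1 + ((blockAge q R j c : Fin (2 * q + 1)) : ℕ))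
      ((2 * q : ℤ) + no + 2 + ((blockAge q R j c : Fin (2 * q + 1)) : ℕ)),
    sum_ite_natCast_eq, sum_ite_natCast_eq, if_pos ⟨by omega, by push_cast; omega⟩,
    if_neg (by push_cast; omega), add_zero,
    show ((no : ℤ) + 1 + ((blockAge q R j c : Fin (2 * q + 1)) : ℕ)).toNat
      = no + 1 + ((blockAge q R j c : Fin (2 * q + 1)) : ℕ) by omega]
  all_goals (intro t; rw [birth3_eq_beta'_iff]; try omega)

end Summit.ValiantsHypothesis.ValiantsHypothesis.Theorems.PeelingLemmaGadget
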